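import Mathlib
import Literature.Analysis.FluidPDE.FlatSwirlGauge
import Summits.NavierStokesRegularity.NavierStokesRegularity.Theorems.PowerGaugeEulerLiouville.Negative.HelicityNotRelaxing

/-!
# Crux `EulerZoomLiouville.PowerGaugeEulerLiouville` (stmt-NavierStokesRegularity-19832) —
# SELF-SIMILAR CLASSICAL EULER COLLAPSE IS HELICITY-FREE OFF THE ENERGY-CRITICAL RATE

Negative-lane / needle-portrait record (prover hand leafhand-ns-eulerzoomliouville-10 g0; `--supports` stmt-19832; def-free),
companion of `…Negative.HelicityNotRelaxing`.  For an exactly self-similar velocity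
`u(t,x) = (−t)^{γ−1} V((−t)^{−γ} x)` on `(−∞,0) × ℝ³` the helicity scales like `H(u(t)) = (−t)^{4γ−2} H(V)`
(`helicity_smul_comp_smul`, `selfSimilar_helicity_factor_eq`); if `(u,p)` is a classical Euler flow whose slices carry the
helicity budgets of `helicity_eq_of_classical_euler` (helicity density integrable, fluxes `∫‖u‖²‖curl u‖`, `∫|p|‖curl u‖`
budgeted locally uniformly in time), the helicity is conserved, so `H(V) = 0` unless `γ = 1/2`
(`helicity_profile_eq_zero_of_selfSimilar_classical`).  In the crux's window the class rate is `γ = 1/(2+ρ) ∈ [2/5, 1/2)`,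
`0 < ρ ≤ 1/2`, never `1/2` (`selfSimilarRate_ne_half`): **every classical self-similar member of the window with the helicity
budgets has a helicity-free profile, `∫⟪V, curl V⟫ = 0`** (`helicity_profile_eq_zero_of_window_rate`) — a constraint on the
needle of `stub_selfSimilarC2Needle` (whose portrait has no axis of symmetry, so chirality is not excluded a priori) and on
the profile door (P) (`…Negative.ProfileEdge`).  Note the budgets are compatible with the window tails `|V| ~ |y|^{−(1+ρ)}`,
`|curl V| ~ |y|^{−(2+ρ)}`: `⟪V,curl V⟫ ~ |y|^{−3−2ρ} ∈ L¹` although `V ∉ L²` — the helicity is the one quadratic invariant that is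
FINITE on window profiles (the energy is not; cf. `…DSSFiniteEnergy.slice_eq_zero_of_dss_finiteEnergy`, which needs `V ∈ L²`).
This is the helicity twin of the energy-scaling exclusion `l^{2ρ−1}` of the crux lineage.

WHAT THIS IS NOT: not a refutation or proof of the crux, of a stub, or of the route; `H(V) = 0` does not force `V = 0`; not a
claim about Navier–Stokes.  [folklore; cite: Moffatt1969 §3; MajdaBertozziCUP2002 §1.7 Prop. 1.12 (iv); ChaeShvydkoy2013 §1
(self-similar ansatz)] -/

noncomputable section
set_option linter.dupNamespace false
namespace Summit.NavierStokesRegularity.NavierStokesRegularity.Theorems.PowerGaugeEulerLiouville.Negative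

open MeasureTheory Set Function Filter Topology Metric Literature.Analysis Literature.Analysis.FluidPDE
open scoped NNReal ENNReal RealInnerProductSpace

/-- **Helicity under the two-parameter dilation group**: `H(k • V(c •)) = k (k c) |c³|⁻¹ H(V)` (junk-robust: `curl` of the
dilated field is `(k c) • (curl V)(c ·)` everywhere, `FlatSwirlGauge.curl_smul_comp_smul`; then the Haar change of variables
`∫ f(c x) dx = |c³|⁻¹ ∫ f`). [folklore] -/
theorem helicity_smul_comp_smul (V : EuclideanSpace ℝ (Fin 3) → EuclideanSpace ℝ (Fin 3)) (k c : ℝ) :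
    helicity (fun x => k • V (c • x)) = k * (k * c) * |(c ^ 3)⁻¹| * helicity V := by
  show (∫ x, ⟪k • V (c • x), curl (fun y => k • V (c • y)) x⟫) = k * (k * c) * |(c ^ 3)⁻¹| * ∫ x, ⟪V x, curl V x⟫
  have h1 : ∀ x : EuclideanSpace ℝ (Fin 3), ⟪k • V (c • x), curl (fun y => k • V (c • y)) x⟫ =
      (k * (k * c)) * (fun z => ⟪V z, curl V z⟫) (c • x) := by
    intro x
    rw [curl_smul_comp_smul, real_inner_smul_left, real_inner_smul_right]
    ring
  simp_rw [h1]
  rw [integral_const_mul, Measure.integral_comp_smul volume (fun z => ⟪V z, curl V z⟫) c]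
  simp only [finrank_euclideanSpace, Fintype.card_fin, smul_eq_mul]
  ring

/-- The self-similar helicity factor: for `λ > 0`, `k = λ^{γ−1}`, `c = λ^{−γ}`: `k (k c) |c³|⁻¹ = λ^{4γ−2}`. [folklore] -/
theorem selfSimilar_helicity_factor_eq {l : ℝ} (hl : 0 < l) (γ : ℝ) :
    l ^ (γ - 1) * (l ^ (γ - 1) * l ^ (-γ)) * |((l ^ (-γ)) ^ 3)⁻¹| = l ^ (4 * γ - 2) := by
  have h3 : ((l ^ (-γ)) ^ 3)⁻¹ = l ^ (3 * γ) := by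
    rw [← Real.rpow_natCast, ← Real.rpow_mul hl.le, ← Real.rpow_neg hl.le]
    congr 1
    push_cast
    ring
  rw [h3, abs_of_pos (Real.rpow_pos_of_pos hl _), ← Real.rpow_add hl, ← Real.rpow_add hl, ← Real.rpow_add hl]
  congr 1
  ring

/-- **Helicity of an exactly self-similar velocity**: if `u(t) = (−t)^{γ−1} • V((−t)^{−γ} •)` for `t < 0` then
`H(u(t)) = (−t)^{4γ−2} H(V)`. [folklore] -/
theorem helicity_selfSimilar_slice {u : ℝ → EuclideanSpace ℝ (Fin 3) → EuclideanSpace ℝ (Fin 3)}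
    {V : EuclideanSpace ℝ (Fin 3) → EuclideanSpace ℝ (Fin 3)} {γ : ℝ}
    (hss : ∀ t : ℝ, t < 0 → u t = fun x => (-t) ^ (γ - 1) • V ((-t) ^ (-γ) • x)) {t : ℝ} (ht : t < 0) :
    helicity (u t) = (-t) ^ (4 * γ - 2) * helicity V := by
  rw [hss t ht, helicity_smul_comp_smul, selfSimilar_helicity_factor_eq (neg_pos.2 ht)]

/-- **SELF-SIMILAR CLASSICAL EULER COLLAPSE IS HELICITY-FREE OFF THE RATE `γ = 1/2`.**  Let `(u,p)` be a classical Euler flow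
on `(−∞,0) × ℝ³` with exactly self-similar velocity `u(t) = (−t)^{γ−1} • V((−t)^{−γ} •)`, `γ ≠ 1/2`, whose slices have
integrable helicity density and budgeted helicity fluxes locally uniformly in time (the hypotheses of
`helicity_eq_of_classical_euler`).  Then `H(V) = ∫⟪V, curl V⟫ = 0`: the conserved helicity equals `(−t)^{4γ−2} H(V)` at every
`t < 0`, and `t = −1`, `t = −2` give `H(V) = 2^{4γ−2} H(V)` with `2^{4γ−2} ≠ 1`. [folklore] -/
theorem helicity_profile_eq_zero_of_selfSimilar_classical
    {u : ℝ → EuclideanSpace ℝ (Fin 3) → EuclideanSpace ℝ (Fin 3)} {p : ℝ → EuclideanSpace ℝ (Fin 3) → ℝ}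
    (hsol : IsClassicalEulerSolutionOn (Iio (0 : ℝ)) 0 u p)
    {V : EuclideanSpace ℝ (Fin 3) → EuclideanSpace ℝ (Fin 3)} {γ : ℝ} (hγ : γ ≠ 1 / 2)
    (hss : ∀ t : ℝ, t < 0 → u t = fun x => (-t) ^ (γ - 1) • V ((-t) ^ (-γ) • x))
    (hunif : ∀ a b : ℝ, a ≤ b → b < 0 → ∃ M' : ℝ, ∀ τ ∈ Icc a b,
      Integrable (fun y => ⟪u τ y, curl (u τ) y⟫) ∧
      (Integrable (fun y => ‖u τ y‖ ^ 2 * ‖curl (u τ) y‖) ∧ ∫ y, ‖u τ y‖ ^ 2 * ‖curl (u τ) y‖ ≤ M') ∧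
      (Integrable (fun y => |p τ y| * ‖curl (u τ) y‖) ∧ ∫ y, |p τ y| * ‖curl (u τ) y‖ ≤ M')) :
    helicity V = 0 := by
  -- conservation between `t = −2` and `t = −1`
  obtain ⟨M', hM'⟩ := hunif (-2) (-1) (by norm_num) (by norm_num)
  have hI : Icc (-2 : ℝ) (-1) ⊆ Iio 0 := fun τ hτ => lt_of_le_of_lt hτ.2 (by norm_num)
  have hcons := helicity_eq_of_classical_euler isOpen_Iio hsol (show (-2 : ℝ) ≤ -1 by norm_num) hI
    (fun τ hτ => (hM' τ hτ).1) (fun τ hτ => (hM' τ hτ).2.1) (fun τ hτ => (hM' τ hτ).2.2)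
  rw [helicity_selfSimilar_slice hss (by norm_num : (-1 : ℝ) < 0),
    helicity_selfSimilar_slice hss (by norm_num : (-2 : ℝ) < 0)] at hcons
  norm_num at hcons
  -- `2^{4γ−2} ≠ 1`
  have hne : (2 : ℝ) ^ (4 * γ - 2) ≠ 1 := by
    rcases lt_or_gt_of_ne (show 4 * γ - 2 ≠ 0 by intro h; exact hγ (by linarith)) with hlt | hgt
    · exact (Real.rpow_lt_one_of_one_lt_of_neg (by norm_num) hlt).ne
    · exact (Real.one_lt_rpow (by norm_num) hgt).ne'
  -- `H(V) = 2^{4γ−2} H(V)` forces `H(V) = 0`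
  have hfac : ((2 : ℝ) ^ (4 * γ - 2) - 1) * helicity V = 0 := by linarith
  rcases mul_eq_zero.1 hfac with h0 | h0
  · exact absurd (sub_eq_zero.1 h0) hne
  · exact h0

/-- The class rate of the crux's window is never the energy-critical rate: `0 < ρ → 1/(2+ρ) ≠ 1/2`. [folklore] -/
theorem selfSimilarRate_ne_half {ρ : ℝ} (hρ : 0 < ρ) : 1 / (2 + ρ) ≠ 1 / 2 := by
  intro h
  have h2 : (2 : ℝ) + ρ ≠ 0 := by positivity
  field_simp at h
  linarith

/-- **In the window, classical self-similar members with the helicity budgets have helicity-free profiles.**  With the class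
rate `γ = 1/(2+ρ)`, `ρ > 0`, of the crux `PowerGaugeEulerLiouville` (Seregin's zoom class; `α = 1+ρ` in Chae–Shvydkoy's
notation): a classical Euler flow on `(−∞,0) × ℝ³` with `u(t) = (−t)^{γ−1} • V((−t)^{−γ} •)` and the helicity budgets has
`∫⟪V, curl V⟫ = 0`; in particular the slices have zero helicity, `H(u(t)) = 0` for all `t < 0`. [folklore] -/
theorem helicity_profile_eq_zero_of_window_rate
    {u : ℝ → EuclideanSpace ℝ (Fin 3) → EuclideanSpace ℝ (Fin 3)} {p : ℝ → EuclideanSpace ℝ (Fin 3) → ℝ}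
    (hsol : IsClassicalEulerSolutionOn (Iio (0 : ℝ)) 0 u p) {ρ : ℝ} (hρ : 0 < ρ)
    {V : EuclideanSpace ℝ (Fin 3) → EuclideanSpace ℝ (Fin 3)}
    (hss : ∀ t : ℝ, t < 0 → u t = fun x => (-t) ^ (1 / (2 + ρ) - 1) • V ((-t) ^ (-(1 / (2 + ρ))) • x))
    (hunif : ∀ a b : ℝ, a ≤ b → b < 0 → ∃ M' : ℝ, ∀ τ ∈ Icc a b,
      Integrable (fun y => ⟪u τ y, curl (u τ) y⟫) ∧
      (Integrable (fun y => ‖u τ y‖ ^ 2 * ‖curl (u τ) y‖) ∧ ∫ y, ‖u τ y‖ ^ 2 * ‖curl (u τ) y‖ ≤ M') ∧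
      (Integrable (fun y => |p τ y| * ‖curl (u τ) y‖) ∧ ∫ y, |p τ y| * ‖curl (u τ) y‖ ≤ M')) :
    helicity V = 0 ∧ ∀ t : ℝ, t < 0 → helicity (u t) = 0 := by
  have hV := helicity_profile_eq_zero_of_selfSimilar_classical hsol (selfSimilarRate_ne_half hρ) hss hunif
  exact ⟨hV, fun t ht => by rw [helicity_selfSimilar_slice hss ht, hV, mul_zero]⟩


/-! ## Discretely self-similar classical members are helicity-free (every `ρ ≠ 0`) -/

/-- The DSS helicity factor: for `l > 0`, `k = l^{1+ρ}`, `c = l`: `k (k c) |c³|⁻¹ = l^{2ρ}`. [folklore] -/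
theorem dss_helicity_factor_eq {l : ℝ} (hl : 0 < l) (ρ : ℝ) :
    l ^ (1 + ρ) * (l ^ (1 + ρ) * l) * |(l ^ 3)⁻¹| = l ^ (2 * ρ) := by
  have h3 : (l ^ 3)⁻¹ = l ^ (-3 : ℝ) := by
    rw [Real.rpow_neg hl.le, ← Real.rpow_natCast]
    norm_num
  rw [abs_of_pos (by positivity), h3]
  conv_lhs => rw [show l ^ (1 + ρ) * (l ^ (1 + ρ) * l) * l ^ (-3 : ℝ) =
      l ^ (1 + ρ) * l ^ (1 + ρ) * l ^ (1 : ℝ) * l ^ (-3 : ℝ) by rw [Real.rpow_one]; ring]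
  rw [← Real.rpow_add hl, ← Real.rpow_add hl, ← Real.rpow_add hl]
  congr 1
  ring

/-- **DISCRETELY SELF-SIMILAR CLASSICAL EULER FLOWS ARE HELICITY-FREE.**  Let `(u,p)` be a classical Euler flow on
`(−∞,0) × ℝ³` which is discretely self-similar under the class scaling of the crux with exponent `ρ ≠ 0` and one factor
`l > 1`, `u(t,x) = l^{1+ρ} u(l^{2+ρ} t, l x)` for `t < 0`, and whose slices carry the helicity budgets of
`helicity_eq_of_classical_euler` locally uniformly in time.  Then `H(u(t)) = 0` for every `t < 0`: the scaling gives
`H(u(t)) = l^{2ρ} H(u(l^{2+ρ} t))` (`helicity_smul_comp_smul`, `dss_helicity_factor_eq`), conservation gives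
`H(u(l^{2+ρ} t)) = H(u(t))`, and `l^{2ρ} ≠ 1`.  (The energy twin `…DSSFiniteEnergy.slice_eq_zero_of_dss_finiteEnergy` needs
`V ∈ L²` and `ρ ≠ 1/2`; the helicity is finite on window tails and the exclusion of chirality holds at EVERY `ρ ≠ 0`.) [folklore] -/
theorem helicity_slice_eq_zero_of_dss_classical
    {u : ℝ → EuclideanSpace ℝ (Fin 3) → EuclideanSpace ℝ (Fin 3)} {p : ℝ → EuclideanSpace ℝ (Fin 3) → ℝ}
    (hsol : IsClassicalEulerSolutionOn (Iio (0 : ℝ)) 0 u p) {ρ l : ℝ} (hρ : ρ ≠ 0) (hl : 1 < l)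
    (hdss : ∀ t : ℝ, t < 0 → u t = fun x => l ^ (1 + ρ) • u (l ^ (2 + ρ) * t) (l • x))
    (hunif : ∀ a b : ℝ, a ≤ b → b < 0 → ∃ M' : ℝ, ∀ τ ∈ Icc a b,
      Integrable (fun y => ⟪u τ y, curl (u τ) y⟫) ∧
      (Integrable (fun y => ‖u τ y‖ ^ 2 * ‖curl (u τ) y‖) ∧ ∫ y, ‖u τ y‖ ^ 2 * ‖curl (u τ) y‖ ≤ M') ∧
      (Integrable (fun y => |p τ y| * ‖curl (u τ) y‖) ∧ ∫ y, |p τ y| * ‖curl (u τ) y‖ ≤ M'))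
    {t : ℝ} (ht : t < 0) : helicity (u t) = 0 := by
  have hl0 : 0 < l := lt_trans zero_lt_one hl
  -- the rescaled time `s = l^{2+ρ} t < 0`
  set s : ℝ := l ^ (2 + ρ) * t with hs
  have hspos : 0 < l ^ (2 + ρ) := Real.rpow_pos_of_pos hl0 _
  have hs0 : s < 0 := mul_neg_of_pos_of_neg hspos ht
  -- conservation between `s` and `t` (in either order)
  have hcons : helicity (u s) = helicity (u t) := by
    rcases le_total s t with hle | hle
    · obtain ⟨M', hM'⟩ := hunif s t hle ht
      have hI : Icc s t ⊆ Iio 0 := fun τ hτ => lt_of_le_of_lt hτ.2 ht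
      exact (helicity_eq_of_classical_euler isOpen_Iio hsol hle hI (fun τ hτ => (hM' τ hτ).1)
        (fun τ hτ => (hM' τ hτ).2.1) (fun τ hτ => (hM' τ hτ).2.2)).symm
    · obtain ⟨M', hM'⟩ := hunif t s hle hs0
      have hI : Icc t s ⊆ Iio 0 := fun τ hτ => lt_of_le_of_lt hτ.2 hs0
      exact helicity_eq_of_classical_euler isOpen_Iio hsol hle hI (fun τ hτ => (hM' τ hτ).1)
        (fun τ hτ => (hM' τ hτ).2.1) (fun τ hτ => (hM' τ hτ).2.2)
  -- scaling: `H(u(t)) = l^{2ρ} H(u(s))`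
  have hscale : helicity (u t) = l ^ (2 * ρ) * helicity (u s) := by
    rw [hdss t ht, helicity_smul_comp_smul, dss_helicity_factor_eq hl0]
  rw [hcons] at hscale
  have hne : l ^ (2 * ρ) ≠ 1 := by
    rcases lt_or_gt_of_ne (show 2 * ρ ≠ 0 by positivity) with hlt | hgt
    · exact (Real.rpow_lt_one_of_one_lt_of_neg hl hlt).ne
    · exact (Real.one_lt_rpow hl hgt).ne'
  have hfac : (l ^ (2 * ρ) - 1) * helicity (u t) = 0 := by linarith
  rcases mul_eq_zero.1 hfac with h0 | h0
  · exact absurd (sub_eq_zero.1 h0) hne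
  · exact h0
end Summit.NavierStokesRegularity.NavierStokesRegularity.Theorems.PowerGaugeEulerLiouville.Negative
end
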